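import Literature.MathematicalPhysics.QuantumLattice.Imbrie2016.A2OfLLA

/-!
# Imbrie (2016): the weak form (5.8) of A2, the instance of A2 the proof of Thm 5.1 CONSUMES, and its γ-uniform
restriction to large blocks (LLA_*) — TYPED STATEMENTS + the elementary arrows between them (kernel-checked)

CITATION HEADER (lean-in-tree rule 2026-08-18). J. Z. Imbrie, *On many-body localization for quantum spin chains*,
J. Stat. Phys. **163** (2016) 998–1048, doi 10.1007/s10955-016-1508-x, arXiv:1403.7837 [ImbrieJSP2016], §5.
WHAT IS TYPED, verbatim sources:
* `A2weak` = printed eq. (5.8) (LaTeX label key (5.5) in the arXiv source): "we could make do with a weaker form of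
  A2(ν,ε₀), replacing (5.1) with P(min_{α≠β}|E_α − E_β| < ε̃ⁿ) ≤ ε̃^{ν(1+c₄(log n)²)}, for some constant c₄."
* `A2consumed` = the instance used in the proof of Thm 5.1 (§5, the paragraph containing printed (5.3)): "where n is the
  number of sites in b̄^{(j)} … the size of b̿^{(j)} is no greater than some multiple m of n … So if we let ε̃ = ε^{sϰ/m} and
  take ε̃ ≤ ε₀, then A2(ν,ε₀) implies that (5.3) [min_{α≠β}|E_α − E_β| ≥ ε^{sϰn}] occurs with probability at least
  1 − ε̃^{νmn} = 1 − ε^{sνϰn}", with ε = γ^{1/20} (§4.3: "γ = ε^{20}").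
* `A2consumedFrom N` = the same for blocks of at least N sites; `LLAstar` = its γ-uniform version over (0, γ₀]
  (the audit cell's sharpest localisation of the hypothesis, GAP.md addendum "(LLA_*)"; for N below
  N_* = 20/(sνϰ) the instance is decided by Weyl's inequality and the γ = 0 count — that part is NOT formalised here).
WHAT IS PROVED: only elementary arrows — A2 ⟹ A2weak (for ε₀ ≤ 1, 0 ≤ ν, c₄ ≤ 1/4: (5.8) is genuinely weaker),
A2 ⟹ A2consumed (the exponent arithmetic of the quoted sentence, for boxes of any size n′ ∈ [n, mn]), and
LLA uniform in γ ⟹ LLA_* (through the landed `A2_of_LLA`).  STATUS: A2, A2weak, A2consumed, LLA_* are HYPOTHESES of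
the paper / of the audit and are never asserted; nothing here bears on their truth.  Audit cell `pub-imbrie`,
unit b2b-imbrie-1-g2 (LLA.md §2, STEPS.md S4, GAP.md addendum, b2b-imbrie-1-g2/BOOTSTRAP-AUDIT.md §5).
-/

noncomputable section
open _root_.MeasureTheory

namespace Literature.MathematicalPhysics.QuantumLattice.Imbrie2016

/-- **Weak form of A2** (Imbrie 2016, printed eq. (5.8); label key (5.5)): for all boxes of n ≥ 1 sites and all
0 < ε̃ ≤ ε₀, P(min gap < ε̃ⁿ) ≤ ε̃^{ν(1 + c₄ (log n)²)}. The paper asserts (without proof) that this suffices for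
Thm 5.1. UNPROVED hypothesis; never asserted here. [cite: ImbrieJSP2016, eq. (5.8)] -/
def A2weak (L : Laws) (γ ν ε₀ c₄ : ℝ) : Prop :=
  ∀ (a : ℤ) (n : ℕ), 0 < n → ∀ ε' : ℝ, 0 < ε' → ε' ≤ ε₀ →
    L.boxMeasure a n {t | SmallGap γ (ε' ^ n) (Params.ofTriple t)}
      ≤ ENNReal.ofReal (ε' ^ (ν * (1 + c₄ * Real.log n ^ 2)))

/-- Elementary: 1 + c₄ (log n)² ≤ n for every n ≥ 1 when c₄ ≤ 1/4 (via log n = 2 log √n ≤ 2(√n − 1)).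
Not sharp (any c₄ ≤ min_n (n−1)/(log n)² ≈ 1.54 would do). [cite: ImbrieJSP2016, eq. (5.8)] -/
theorem one_add_mul_log_sq_le {c₄ : ℝ} (hc' : c₄ ≤ 1 / 4) {n : ℕ} (hn : 0 < n) :
    1 + c₄ * Real.log n ^ 2 ≤ n := by
  have hn1 : (1 : ℝ) ≤ n := by exact_mod_cast hn
  have hn0 : (0 : ℝ) ≤ n := by positivity
  set s : ℝ := Real.sqrt n with hs
  have hs0 : 0 ≤ s := Real.sqrt_nonneg _
  have hss : s ^ 2 = n := Real.sq_sqrt hn0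
  have hs1 : 1 ≤ s := by
    by_contra h
    have h' : s < 1 := lt_of_not_ge h
    have : s ^ 2 < 1 := by nlinarith
    linarith
  have hspos : 0 < s := by linarith
  have hlog : Real.log n = 2 * Real.log s := by
    rw [← hss, Real.log_pow]; simp
  have hls0 : 0 ≤ Real.log s := Real.log_nonneg hs1
  have hls1 : Real.log s ≤ s - 1 := Real.log_le_sub_one_of_pos hspos
  have h2 : Real.log s ^ 2 ≤ (s - 1) ^ 2 := by nlinarith
  have h3 : c₄ * Real.log n ^ 2 ≤ (s - 1) ^ 2 := by
    rw [hlog]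
    have : c₄ * (2 * Real.log s) ^ 2 = (4 * c₄) * Real.log s ^ 2 := by ring
    rw [this]
    have h4 : 4 * c₄ ≤ 1 := by linarith
    calc (4 * c₄) * Real.log s ^ 2 ≤ 1 * Real.log s ^ 2 :=
          mul_le_mul_of_nonneg_right h4 (by positivity)
      _ ≤ (s - 1) ^ 2 := by rw [one_mul]; exact h2
  have h5 : (s - 1) ^ 2 = n - 2 * s + 1 := by rw [← hss]; ring
  linarith

/-- **A2(ν, ε₀) ⟹ A2weak(ν, ε₀, c₄)** whenever ε₀ ≤ 1, 0 ≤ ν and c₄ ≤ 1/4: the weak form (5.8) is implied by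
(5.1) (monotonicity of x ↦ ε̃^x for ε̃ ≤ 1). Hypotheses only; neither side is asserted. [cite: ImbrieJSP2016, eq. (5.8)] -/
theorem A2weak_of_A2 {L : Laws} {γ ν ε₀ c₄ : ℝ} (hν : 0 ≤ ν) (hε₀ : ε₀ ≤ 1)
    (hc' : c₄ ≤ 1 / 4) (h : A2 L γ ν ε₀) : A2weak L γ ν ε₀ c₄ := by
  intro a n hn ε' hε' hle
  refine (h a n hn ε' hε' hle).trans (ENNReal.ofReal_le_ofReal ?_)
  apply Real.rpow_le_rpow_of_exponent_ge hε' (hle.trans hε₀)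
  exact mul_le_mul_of_nonneg_left (one_add_mul_log_sq_le hc' hn) hν

/-- **The consumed instance of A2** (Imbrie 2016, §5, proof of Thm 5.1, paragraph of printed (5.3)): for a block of
n ≥ 1 sites whose (double-)collar box has n′ sites, n ≤ n′ ≤ m·n, the box Hamiltonian satisfies
P(min gap < ε^{sϰn}) ≤ ε^{sνϰn}, ε = γ^{1/20} (s = 2/7, ϰ small, m the collar multiple). This, not LLA, is what the
multiscale argument uses. UNPROVED hypothesis; never asserted here. [cite: ImbrieJSP2016, §5 proof of Thm 5.1] -/
def A2consumed (L : Laws) (γ ν s ϰ : ℝ) (m : ℕ) : Prop :=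
  ∀ (a : ℤ) (n n' : ℕ), 0 < n → n ≤ n' → n' ≤ m * n →
    L.boxMeasure a n' {t | SmallGap γ ((γ ^ (1 / 20 : ℝ)) ^ (s * ϰ * n)) (Params.ofTriple t)}
      ≤ ENNReal.ofReal ((γ ^ (1 / 20 : ℝ)) ^ (s * ν * ϰ * n))

/-- **A2(ν, ε₀) ⟹ A2consumed** as soon as ε̃ := ε^{sϰ/m} ≤ ε₀ (ε = γ^{1/20}, 0 < γ ≤ 1, s, ϰ ≥ 0): the exponent
arithmetic of the quoted sentence, done for a box of any size n′ ∈ [n, mn] with ε′ = ε^{sϰn/n′} ≤ ε̃, so that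
ε′^{n′} = ε^{sϰn} and ε′^{νn′} = ε^{sνϰn}. [cite: ImbrieJSP2016, §5 proof of Thm 5.1] -/
theorem A2consumed_of_A2 {L : Laws} {γ ν ε₀ s ϰ : ℝ} {m : ℕ} (hγ : 0 < γ) (hγ1 : γ ≤ 1)
    (hs : 0 ≤ s) (hϰ : 0 ≤ ϰ) (hε₀ : (γ ^ (1 / 20 : ℝ)) ^ (s * ϰ / m) ≤ ε₀) (h : A2 L γ ν ε₀) :
    A2consumed L γ ν s ϰ m := by
  intro a n n' hn hnn' hn'm
  have hε0 : 0 < γ ^ (1 / 20 : ℝ) := Real.rpow_pos_of_pos hγ _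
  have hε1 : γ ^ (1 / 20 : ℝ) ≤ 1 := Real.rpow_le_one hγ.le hγ1 (by norm_num)
  have hn'0 : 0 < n' := lt_of_lt_of_le hn hnn'
  have hn'R : (0 : ℝ) < n' := by exact_mod_cast hn'0
  have hnR : (0 : ℝ) < n := by exact_mod_cast hn
  have hm0 : 0 < m := by
    rcases Nat.eq_zero_or_pos m with hm | hm
    · subst hm; simp at hn'm; omega
    · exact hm
  have hmR : (0 : ℝ) < m := by exact_mod_cast hm0
  have hle : (n' : ℝ) ≤ m * n := by exact_mod_cast hn'm
  -- the exponent used in the box of size n'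
  have hexp : s * ϰ / m ≤ s * ϰ * n / n' := by
    have hsk : 0 ≤ s * ϰ := mul_nonneg hs hϰ
    have h1 : (1 : ℝ) / m ≤ n / n' := by
      rw [le_div_iff₀ hn'R]
      calc (1 : ℝ) / m * n' ≤ 1 / m * (m * n) := mul_le_mul_of_nonneg_left hle (by positivity)
        _ = n := by field_simp
    have h2 : s * ϰ / m = (s * ϰ) * (1 / m) := by ring
    have h3 : s * ϰ * n / n' = (s * ϰ) * (n / n') := by ring
    rw [h2, h3]
    exact mul_le_mul_of_nonneg_left h1 hsk
  have hε'0 : 0 < (γ ^ (1 / 20 : ℝ)) ^ (s * ϰ * n / n') := Real.rpow_pos_of_pos hε0 _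
  have hε'le : (γ ^ (1 / 20 : ℝ)) ^ (s * ϰ * n / n') ≤ ε₀ :=
    (Real.rpow_le_rpow_of_exponent_ge hε0 hε1 hexp).trans hε₀
  have key := h a n' hn'0 _ hε'0 hε'le
  have e1 : ((γ ^ (1 / 20 : ℝ)) ^ (s * ϰ * n / n')) ^ n' = (γ ^ (1 / 20 : ℝ)) ^ (s * ϰ * n) := by
    rw [← Real.rpow_natCast, ← Real.rpow_mul hε0.le]
    congr 1
    field_simp
  have e2 : ((γ ^ (1 / 20 : ℝ)) ^ (s * ϰ * n / n')) ^ (ν * n') = (γ ^ (1 / 20 : ℝ)) ^ (s * ν * ϰ * n) := by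
    rw [← Real.rpow_mul hε0.le]
    congr 1
    field_simp
  rw [e1, e2] at key
  exact key

/-- The consumed instance restricted to blocks of at least N sites (the audit's "honest minimal hypothesis for the theorem as
printed", REPAIR-CENSUS V11(iv): for N = N_* = ⌈20/(sνϰ)⌉ the blocks below N are decided by Weyl + the γ = 0 count,
LLA.md P2 — not formalised here). UNPROVED hypothesis; never asserted. [cite: ImbrieJSP2016, §5 proof of Thm 5.1] -/
def A2consumedFrom (L : Laws) (γ ν s ϰ : ℝ) (m N : ℕ) : Prop :=
  ∀ (a : ℤ) (n n' : ℕ), 0 < n → N ≤ n → n ≤ n' → n' ≤ m * n →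
    L.boxMeasure a n' {t | SmallGap γ ((γ ^ (1 / 20 : ℝ)) ^ (s * ϰ * n)) (Params.ofTriple t)}
      ≤ ENNReal.ofReal ((γ ^ (1 / 20 : ℝ)) ^ (s * ν * ϰ * n))

/-- restriction is free in one direction. [cite: ImbrieJSP2016, §5 proof of Thm 5.1] -/
theorem A2consumedFrom_of_A2consumed {L : Laws} {γ ν s ϰ : ℝ} {m : ℕ} (N : ℕ)
    (h : A2consumed L γ ν s ϰ m) : A2consumedFrom L γ ν s ϰ m N :=
  fun a n n' hn _ hnn' hn'm => h a n n' hn hnn' hn'm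

/-- and `N = 0` is the unrestricted instance. [cite: ImbrieJSP2016, §5 proof of Thm 5.1] -/
theorem A2consumed_iff_from_zero {L : Laws} {γ ν s ϰ : ℝ} {m : ℕ} :
    A2consumed L γ ν s ϰ m ↔ A2consumedFrom L γ ν s ϰ m 0 :=
  ⟨fun h => A2consumedFrom_of_A2consumed 0 h, fun h a n n' hn hnn' hn'm => h a n n' hn (Nat.zero_le _) hnn' hn'm⟩

/-- **(LLA_*)** — the audit cell's sharpest form of what Thm 1.1 consumes (GAP.md addendum): the consumed instance for blocks of
≥ N sites, with ONE exponent ν for all couplings γ ∈ (0, γ₀] (the quantifier order of Thm 1.1: ν fixed before γ is taken small).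
UNPROVED for N ≥ N_*; never asserted here. [cite: ImbrieJSP2016, Thm 1.1 and §5 proof of Thm 5.1] -/
def LLAstar (L : Laws) (ν s ϰ γ₀ : ℝ) (m N : ℕ) : Prop :=
  ∀ γ, 0 < γ → γ ≤ γ₀ → A2consumedFrom L γ ν s ϰ m N

/-- **LLA(ν, C) uniformly in γ ∈ (0, γ₁] ⟹ (LLA_*) with any exponent ν′ < ν on some (0, γ₀]** — the composite of the paper's two
elementary arrows (LLA ⟹ A2(ν′, C^(−1/(ν−ν′))), landed as `A2_of_LLA`, and A2 ⟹ A2consumed once ε^{sϰ/m} ≤ ε₀), with the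
explicit γ₀ = min(γ₁, 1, ε₀^{20m/(sϰ)}). Hypotheses only. [cite: ImbrieJSP2016, Cor 5.2 and §5 proof of Thm 5.1] -/
theorem exists_LLAstar_of_LLA_uniform {L : Laws} {ν ν' C s ϰ : ℝ} {m : ℕ} (N : ℕ) (hC : 0 < C) (hν : ν' < ν)
    (hs : 0 < s) (hϰ : 0 < ϰ) (hm : 0 < m) (h : LLA_uniformInSmallCoupling L ν C) :
    ∃ γ₀ > 0, LLAstar L ν' s ϰ γ₀ m N := by
  obtain ⟨γ₁, hγ₁, hL⟩ := h
  set ε₀ : ℝ := C ^ (-(1 / (ν - ν'))) with hε₀def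
  have hε₀ : 0 < ε₀ := Real.rpow_pos_of_pos hC _
  set p : ℝ := (1 / 20) * (s * ϰ / m) with hpdef
  have hmR : (0 : ℝ) < m := by exact_mod_cast hm
  have hp : 0 < p := by positivity
  set γ₂ : ℝ := ε₀ ^ (1 / p) with hγ₂def
  have hγ₂ : 0 < γ₂ := Real.rpow_pos_of_pos hε₀ _
  refine ⟨min γ₁ (min 1 γ₂), lt_min hγ₁ (lt_min one_pos hγ₂), ?_⟩
  intro γ hγ hγle
  have hγ1' : γ ≤ γ₁ := hγle.trans (min_le_left _ _)
  have hγone : γ ≤ 1 := hγle.trans ((min_le_right _ _).trans (min_le_left _ _))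
  have hγ2' : γ ≤ γ₂ := hγle.trans ((min_le_right _ _).trans (min_le_right _ _))
  have hA2 : A2 L γ ν' ε₀ := A2_of_LLA hC hν (hL γ hγ hγ1')
  have hsmall : (γ ^ (1 / 20 : ℝ)) ^ (s * ϰ / m) ≤ ε₀ := by
    rw [← Real.rpow_mul hγ.le]
    have e : γ₂ ^ p = ε₀ := by
      rw [hγ₂def, ← Real.rpow_mul hε₀.le]
      have : 1 / p * p = 1 := by field_simp
      rw [this, Real.rpow_one]
    calc γ ^ ((1 / 20 : ℝ) * (s * ϰ / m)) = γ ^ p := by rw [hpdef]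
      _ ≤ γ₂ ^ p := Real.rpow_le_rpow hγ.le hγ2' hp.le
      _ = ε₀ := e
  exact A2consumedFrom_of_A2consumed N (A2consumed_of_A2 hγ hγone hs.le hϰ.le hsmall hA2)

end Literature.MathematicalPhysics.QuantumLattice.Imbrie2016
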